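import Mathlib.Analysis.SpecialFunctions.Integrals.Basic
import Mathlib.Analysis.SpecialFunctions.Sqrt
import HarnessLib

/-!
# Three elementary definite integrals for the section function `Ψ`

The closed form of Lovas–Andai's defect density (2017, Appendix A: the `ρ`- and `φ`-integrations
ending in `(8/3)(cosh t − sinh²t log((eᵗ+1)/(eᵗ−1)))`) needs, in our coordinates, only the
following antiderivatives (`b, k > 0`, `b > 1` in the second):

* `integral_sqrt_sq_mul_sq_add_sq` : `∫₀ᶜ √(b²p² + k²) dp = (c/2)√(b²c² + k²) + (k²/2b)(log(bc + √(b²c² + k²)) − log k)`;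
* `integral_sq_sub_sq_mul_log_sub` : `∫₀¹ (b² − r²) log(b − r) dr = (b² − 1/3 − 2b³/3) log(b − 1) + (2b³/3) log b + 1/9 + b/6 − 2b²/3`;
* `integral_sq_sub_sq_mul_log_add` : `∫₀¹ (b² − r²) log(b + r) dr = (b² − 1/3 + 2b³/3) log(b + 1) − (2b³/3) log b + 1/9 − b/6 − 2b²/3`.

## References

* [LovasAndai2017] A. Lovas, A. Andai, Invariance of separability probability over reduced states
  in 4 × 4 bipartite systems, J. Phys. A 50 (2017) 295303, Appendix A.
-/

noncomputable section

open MeasureTheory Set Real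

namespace Literature.InformationTheory.Entanglement

/-- The antiderivative of `√(b²p² + k²)`:
`G(p) = (p/2)√(b²p² + k²) + (k²/2b) log(bp + √(b²p² + k²))`. [folklore] -/
theorem hasDerivAt_sqrt_sq_mul_sq_add_sq {b k : ℝ} (hb : 0 < b) (hk : 0 < k) (p : ℝ) :
    HasDerivAt (fun p : ℝ => p / 2 * Real.sqrt (b ^ 2 * p ^ 2 + k ^ 2) +
        k ^ 2 / (2 * b) * Real.log (b * p + Real.sqrt (b ^ 2 * p ^ 2 + k ^ 2)))
      (Real.sqrt (b ^ 2 * p ^ 2 + k ^ 2)) p := by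
  set R := Real.sqrt (b ^ 2 * p ^ 2 + k ^ 2) with hR_def
  have hQpos : 0 < b ^ 2 * p ^ 2 + k ^ 2 := by positivity
  have hRpos : 0 < R := Real.sqrt_pos.2 hQpos
  have hRsq : R ^ 2 = b ^ 2 * p ^ 2 + k ^ 2 := Real.sq_sqrt hQpos.le
  have hbpR : 0 < b * p + R := by
    have h1 : |b * p| < R := by
      rw [← Real.sqrt_sq_eq_abs, hR_def]
      apply Real.sqrt_lt_sqrt (sq_nonneg _)
      nlinarith [sq_nonneg (b * p)]
    linarith [neg_abs_le (b * p)]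
  -- the pieces
  have hQ : HasDerivAt (fun p : ℝ => b ^ 2 * p ^ 2 + k ^ 2) (b ^ 2 * (2 * p)) p := by
    have h := ((hasDerivAt_pow 2 p).const_mul (b ^ 2)).add_const (k ^ 2)
    refine h.congr_deriv ?_
    simp only [Nat.cast_ofNat, pow_one, Nat.add_one_sub_one]
  have hR : HasDerivAt (fun p : ℝ => Real.sqrt (b ^ 2 * p ^ 2 + k ^ 2))
      (b ^ 2 * (2 * p) / (2 * R)) p := hQ.sqrt hQpos.ne'
  have hid : HasDerivAt (fun p : ℝ => p / 2) (1 / 2) p := (hasDerivAt_id' p).div_const 2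
  have h1 := hid.fun_mul hR
  have hin : HasDerivAt (fun p : ℝ => b * p + Real.sqrt (b ^ 2 * p ^ 2 + k ^ 2))
      (b * 1 + b ^ 2 * (2 * p) / (2 * R)) p := ((hasDerivAt_id' p).const_mul b).fun_add hR
  have hL := (hin.log hbpR.ne').const_mul (k ^ 2 / (2 * b))
  refine (h1.fun_add hL).congr_deriv ?_
  simp only [← hR_def]
  have hne : b * p + R ≠ 0 := hbpR.ne'
  have hRne : R ≠ 0 := hRpos.ne'
  have hbne : b ≠ 0 := hb.ne'
  have e1 : (b * 1 + b ^ 2 * (2 * p) / (2 * R)) / (b * p + R) = b / R := by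
    field_simp
    ring
  rw [e1]
  field_simp
  nlinarith [hRsq]

/-- **`∫₀ᶜ √(b²p² + k²) dp`** (`b, k > 0`). [folklore] -/
theorem integral_sqrt_sq_mul_sq_add_sq {b k : ℝ} (hb : 0 < b) (hk : 0 < k) (c : ℝ) :
    ∫ p in (0 : ℝ)..c, Real.sqrt (b ^ 2 * p ^ 2 + k ^ 2) =
      c / 2 * Real.sqrt (b ^ 2 * c ^ 2 + k ^ 2) +
        k ^ 2 / (2 * b) * (Real.log (b * c + Real.sqrt (b ^ 2 * c ^ 2 + k ^ 2)) - Real.log k) := by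
  rw [intervalIntegral.integral_eq_sub_of_hasDerivAt
    (fun p _ => hasDerivAt_sqrt_sq_mul_sq_add_sq hb hk p)
    ((by fun_prop : Continuous fun p : ℝ => Real.sqrt (b ^ 2 * p ^ 2 + k ^ 2)).intervalIntegrable
      0 c)]
  have hk0 : Real.sqrt (k ^ 2) = k := Real.sqrt_sq hk.le
  simp only [mul_zero, zero_pow two_ne_zero, zero_add, zero_div, zero_mul, hk0]
  ring

/-- The antiderivative of `(b² − r²) log(b − r)` on `r < b`. [folklore] -/
theorem hasDerivAt_sq_sub_sq_mul_log_sub {b r : ℝ} (hr : r < b) :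
    HasDerivAt (fun r : ℝ => (b ^ 2 * r - r ^ 3 / 3 - 2 * b ^ 3 / 3) * Real.log (b - r) +
        r ^ 3 / 9 + b * r ^ 2 / 6 - 2 * b ^ 2 * r / 3)
      ((b ^ 2 - r ^ 2) * Real.log (b - r)) r := by
  have hbr : b - r ≠ 0 := by linarith
  have hP : HasDerivAt (fun r : ℝ => b ^ 2 * r - r ^ 3 / 3 - 2 * b ^ 3 / 3) (b ^ 2 - r ^ 2) r := by
    have h := (((hasDerivAt_id' r).const_mul (b ^ 2)).fun_sub
      ((hasDerivAt_pow 3 r).div_const 3)).sub_const (2 * b ^ 3 / 3)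
    refine h.congr_deriv ?_
    simp only [Nat.cast_ofNat, Nat.add_one_sub_one]
    ring
  have hL : HasDerivAt (fun r : ℝ => Real.log (b - r)) ((-1) / (b - r)) r := by
    have h := (hasDerivAt_const r b).fun_sub (hasDerivAt_id' r)
    exact (h.log hbr).congr_deriv (by ring)
  have h1 := hP.fun_mul hL
  have h2 : HasDerivAt (fun r : ℝ => r ^ 3 / 9) (3 * r ^ 2 / 9) r := by
    have h := (hasDerivAt_pow 3 r).div_const 9
    refine h.congr_deriv ?_
    simp only [Nat.cast_ofNat, Nat.add_one_sub_one]
  have h3 : HasDerivAt (fun r : ℝ => b * r ^ 2 / 6) (b * (2 * r) / 6) r := by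
    have h := ((hasDerivAt_pow 2 r).const_mul b).div_const 6
    refine h.congr_deriv ?_
    simp only [Nat.cast_ofNat, pow_one, Nat.add_one_sub_one]
  have h4 : HasDerivAt (fun r : ℝ => 2 * b ^ 2 * r / 3) (2 * b ^ 2 * 1 / 3) r :=
    ((hasDerivAt_id' r).const_mul (2 * b ^ 2)).div_const 3
  have h := ((h1.fun_add h2).fun_add h3).fun_sub h4
  refine h.congr_deriv ?_
  field_simp
  ring

/-- **`∫₀¹ (b² − r²) log(b − r) dr`** (`b > 1`). [folklore] -/
theorem integral_sq_sub_sq_mul_log_sub {b : ℝ} (hb : 1 < b) :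
    ∫ r in (0 : ℝ)..1, (b ^ 2 - r ^ 2) * Real.log (b - r) =
      (b ^ 2 - 1 / 3 - 2 * b ^ 3 / 3) * Real.log (b - 1) + 2 * b ^ 3 / 3 * Real.log b +
        1 / 9 + b / 6 - 2 * b ^ 2 / 3 := by
  have hcont : ContinuousOn (fun r : ℝ => (b ^ 2 - r ^ 2) * Real.log (b - r)) (uIcc 0 1) := by
    apply ContinuousOn.mul (by fun_prop)
    apply ContinuousOn.log (by fun_prop)
    intro r hr
    rw [uIcc_of_le zero_le_one] at hr
    have := hr.2
    linarith
  have hderiv : ∀ r ∈ uIcc (0 : ℝ) 1, HasDerivAt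
      (fun r : ℝ => (b ^ 2 * r - r ^ 3 / 3 - 2 * b ^ 3 / 3) * Real.log (b - r) +
        r ^ 3 / 9 + b * r ^ 2 / 6 - 2 * b ^ 2 * r / 3)
      ((b ^ 2 - r ^ 2) * Real.log (b - r)) r := by
    intro r hr
    rw [uIcc_of_le zero_le_one] at hr
    exact hasDerivAt_sq_sub_sq_mul_log_sub (by linarith [hr.2])
  rw [intervalIntegral.integral_eq_sub_of_hasDerivAt hderiv hcont.intervalIntegrable]
  simp only [mul_one, one_pow, mul_zero, zero_pow three_ne_zero, zero_div, sub_zero, zero_sub,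
    zero_pow two_ne_zero, add_zero]
  ring

/-- The antiderivative of `(b² − r²) log(b + r)` on `−b < r`. [folklore] -/
theorem hasDerivAt_sq_sub_sq_mul_log_add {b r : ℝ} (hr : -b < r) :
    HasDerivAt (fun r : ℝ => (b ^ 2 * r - r ^ 3 / 3 + 2 * b ^ 3 / 3) * Real.log (b + r) +
        r ^ 3 / 9 - b * r ^ 2 / 6 - 2 * b ^ 2 * r / 3)
      ((b ^ 2 - r ^ 2) * Real.log (b + r)) r := by
  have hbr : b + r ≠ 0 := by linarith
  have hP : HasDerivAt (fun r : ℝ => b ^ 2 * r - r ^ 3 / 3 + 2 * b ^ 3 / 3) (b ^ 2 - r ^ 2) r := by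
    have h := (((hasDerivAt_id' r).const_mul (b ^ 2)).fun_sub
      ((hasDerivAt_pow 3 r).div_const 3)).add_const (2 * b ^ 3 / 3)
    refine h.congr_deriv ?_
    simp only [Nat.cast_ofNat, Nat.add_one_sub_one]
    ring
  have hL : HasDerivAt (fun r : ℝ => Real.log (b + r)) (1 / (b + r)) r := by
    have h := (hasDerivAt_const r b).fun_add (hasDerivAt_id' r)
    exact (h.log hbr).congr_deriv (by ring)
  have h1 := hP.fun_mul hL
  have h2 : HasDerivAt (fun r : ℝ => r ^ 3 / 9) (3 * r ^ 2 / 9) r := by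
    have h := (hasDerivAt_pow 3 r).div_const 9
    refine h.congr_deriv ?_
    simp only [Nat.cast_ofNat, Nat.add_one_sub_one]
  have h3 : HasDerivAt (fun r : ℝ => b * r ^ 2 / 6) (b * (2 * r) / 6) r := by
    have h := ((hasDerivAt_pow 2 r).const_mul b).div_const 6
    refine h.congr_deriv ?_
    simp only [Nat.cast_ofNat, pow_one, Nat.add_one_sub_one]
  have h4 : HasDerivAt (fun r : ℝ => 2 * b ^ 2 * r / 3) (2 * b ^ 2 * 1 / 3) r :=
    ((hasDerivAt_id' r).const_mul (2 * b ^ 2)).div_const 3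
  have h := ((h1.fun_add h2).fun_sub h3).fun_sub h4
  refine h.congr_deriv ?_
  field_simp
  ring

/-- **`∫₀¹ (b² − r²) log(b + r) dr`** (`b > 0`). [folklore] -/
theorem integral_sq_sub_sq_mul_log_add {b : ℝ} (hb : 0 < b) :
    ∫ r in (0 : ℝ)..1, (b ^ 2 - r ^ 2) * Real.log (b + r) =
      (b ^ 2 - 1 / 3 + 2 * b ^ 3 / 3) * Real.log (b + 1) - 2 * b ^ 3 / 3 * Real.log b +
        1 / 9 - b / 6 - 2 * b ^ 2 / 3 := by
  have hcont : ContinuousOn (fun r : ℝ => (b ^ 2 - r ^ 2) * Real.log (b + r)) (uIcc 0 1) := by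
    apply ContinuousOn.mul (by fun_prop)
    apply ContinuousOn.log (by fun_prop)
    intro r hr
    rw [uIcc_of_le zero_le_one] at hr
    have := hr.1
    linarith
  have hderiv : ∀ r ∈ uIcc (0 : ℝ) 1, HasDerivAt
      (fun r : ℝ => (b ^ 2 * r - r ^ 3 / 3 + 2 * b ^ 3 / 3) * Real.log (b + r) +
        r ^ 3 / 9 - b * r ^ 2 / 6 - 2 * b ^ 2 * r / 3)
      ((b ^ 2 - r ^ 2) * Real.log (b + r)) r := by
    intro r hr
    rw [uIcc_of_le zero_le_one] at hr
    exact hasDerivAt_sq_sub_sq_mul_log_add (by linarith [hr.1])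
  rw [intervalIntegral.integral_eq_sub_of_hasDerivAt hderiv hcont.intervalIntegrable]
  simp only [mul_one, one_pow, mul_zero, zero_pow three_ne_zero, zero_div, sub_zero,
    zero_pow two_ne_zero, add_zero]
  ring

end Literature.InformationTheory.Entanglement

end
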